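import Literature.IUT.HodgeTheaters.KappaCoricRatGaloisCritLocusGeom
import Literature.IUT.HodgeTheaters.KappaCoricGaloisInvariantsProofs
import HarnessLib

/-!
# [IUTchI] Rmk 3.1.7 (i)/(ii) at the datum's strictly critical locus — proof-only companion

S. Mochizuki, *Inter-universal Teichmüller theory I*, §3, Remark 3.1.7 (i), (ii) (kurims final
manuscript May 2020, pp. 66–67) and Definition 3.1 (a)(b) (p. 61) [claim: Mochizuki2012, status: disputed].
PROOF-ONLY companion (theorems only; no definition, no instance, no notation, no new `Prop` fact) of
`Literature/IUT/HodgeTheaters/KappaCoricRatGaloisCritLocusGeom.lean` (cell `abc-iut`, GAP B item GB-04: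
`CriticalLocus.critMap`, `CriticalLocus.ofTwoTorsion`, `InitialThetaData.critLocusGeom`).

Recorded here, for the consumers of the ruled locus `D.critLocusGeom : CriticalLocus Fbar` of initial
Θ-data `D : InitialThetaData F K Fbar E l P` (GB-01 `∞κ`-coric pair, GB-06 geometric clause (a),
GB-10/GB-12 the arithmetic link and its non-vacuity corollary):

* `CriticalLocus.ofTwoTorsion_baseChange` — for a tower `F → K → Ω` the geometric locus of
  `E_K := E ×_F K` in `Ω` IS that of `E` (print, Def. 3.1 (d): `C_K := C_F ×_F K` has the same critical
  points); `CriticalLocus.ofTwoTorsion_rmk317ii` — Rmk 3.1.7 (ii) holds AT the geometric locus of every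
  elliptic curve over a number field (the landed dischargers of `KappaCoricFunctionsExistence.lean`).
* F-RATIONALITY at the datum (memo GAP-SIZING-B R4, Def. 3.1 (b)): every point of `D.critLocusGeom` is
  the image of a point of the `F`-rational locus `D.critLocus` (`exists_mem_pts_critLocus_eq`), hence is
  FIXED by every `σ ∈ G_F = Fbar ≃ₐ[F] Fbar` (`algEquiv_apply_of_mem_pts_critLocusGeom`) and algebraic
  over `ℚ` (`isAlgebraic_of_mem_pts_critLocusGeom`).
* NON-VACUITY of the `κ`-coric vocabulary AT THE DATUM'S GENUINE LOCUS: a `κ`-coric rational function of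
  degree `4` on `C` exists and every value of `F̄` is attained off the critical points
  (`critLocusGeom_rmk317ii`); consequently a NON-CONSTANT `κ`-coric `f ∈ F̄(t)` exists
  (`exists_isKappaCoric_critLocusGeom`) whose image in ANY field `Λ ⊇ F̄(t)` is `∞κ`-coric
  (`exists_isInftyKappaCoricIn_critLocusGeom`) — so the `∞κ`-coric set that GB-01 packages at this
  locus has a non-unit element, and clause (a) of [IUTchI] Ex. 5.4 (iv) is not vacuous at the datum.

Honest label: model-level content at the REAL datum (count-neutral, RULINGS #316 (i)); nothing here
bears on the disputed parts of the series; no side taken on [IUTchIII] Cor. 3.12 or any author; no abc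
claim.
-/

noncomputable section

open Polynomial
open scoped Classical

universe u v w u' v'

namespace Literature.IUT.HodgeTheaters

namespace CriticalLocus

section Geom

variable {F : Type u} [Field F] [NeZero (2 : F)] (E : WeierstrassCurve F) [E.IsElliptic]
  (Ω : Type v) [Field Ω] [Algebra F Ω]

/-- **Base change** (Def. 3.1 (d): `C_K := C_F ×_F K` has the same critical points): for a tower
`F → K → Ω` with `Ω` algebraically closed, the geometric locus of `E_K := E ×_F K` in `Ω` is the
geometric locus of `E`. [claim: Mochizuki2012, status: disputed] -/
theorem ofTwoTorsion_baseChange {K : Type u'} [Field K] [NeZero (2 : K)] [Algebra F K] [Algebra K Ω]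
    [IsScalarTower F K Ω] [IsAlgClosed Ω] :
    ofTwoTorsion (E.baseChange K) Ω = ofTwoTorsion E Ω := by
  apply ext_pts
  rw [ofTwoTorsion_pts, ofTwoTorsion_pts]
  congr 2
  have hmap : (E.baseChange K).twoTorsionPolynomial.toPoly =
      E.twoTorsionPolynomial.toPoly.map (algebraMap F K) := by
    change (E.map (algebraMap F K)).twoTorsionPolynomial.toPoly = _
    rw [← Cubic.map_toPoly]
    simp only [WeierstrassCurve.twoTorsionPolynomial, Cubic.map, WeierstrassCurve.map_b₂,
      WeierstrassCurve.map_b₄, WeierstrassCurve.map_b₆, map_ofNat, map_mul]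
  rw [hmap, Polynomial.map_map, ← IsScalarTower.algebraMap_eq]

/-- A point of the geometric locus is a root in `Ω` of the `2`-division cubic.
[claim: Mochizuki2012, status: disputed] -/
theorem isRoot_of_mem_pts_ofTwoTorsion [IsAlgClosed Ω] {x : Ω} (hx : x ∈ (ofTwoTorsion E Ω).pts) :
    (E.twoTorsionPolynomial.toPoly.map (algebraMap F Ω)).IsRoot x :=
  (mem_pts_ofTwoTorsionOfSplits_iff E _ _ x).mp hx

/-- **Rmk 3.1.7 (ii) AT THE GEOMETRIC LOCUS** of an elliptic curve over a NUMBER FIELD `F`, read in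
an algebraically closed `Ω ⊇ F`: "there exists a `κ`-coric `f_sol` of degree `4`" and "every element
of `L̄` appears as a value of some `κ`-coric rational function at a non-critical point" (the landed
dischargers `existsKappaCoricDegreeFour_holds` / `everyValueAttained_holds`, whose algebraicity
hypothesis is `isAlgebraic_of_mem_pts_ofTwoTorsion`). [claim: Mochizuki2012, status: disputed] -/
theorem ofTwoTorsion_rmk317ii [NumberField F] [CharZero Ω] [IsAlgClosed Ω] :
    (ofTwoTorsion E Ω).ExistsKappaCoricDegreeFour ∧ (ofTwoTorsion E Ω).EveryValueAttained Set.univ :=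
  ⟨(ofTwoTorsion E Ω).existsKappaCoricDegreeFour_holds (isAlgebraic_of_mem_pts_ofTwoTorsion E Ω),
    (ofTwoTorsion E Ω).everyValueAttained_holds (isAlgebraic_of_mem_pts_ofTwoTorsion E Ω)⟩

/-- The geometric locus is stable (as a set) under every `F`-automorphism of `Ω` (e.g. `Gal(F̄/F)`).
[claim: Mochizuki2012, status: disputed] -/
theorem critMap_ofTwoTorsion_algEquiv [IsAlgClosed Ω] (σ : Ω ≃ₐ[F] Ω) :
    (ofTwoTorsion E Ω).critMap (σ : Ω →+* Ω) = ofTwoTorsion E Ω :=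
  critMap_ofTwoTorsion_ringHom E Ω _ (RingHom.ext fun x => σ.commutes x)

/-- Pointwise form: an `F`-automorphism of `Ω` permutes the geometric strictly critical points.
[claim: Mochizuki2012, status: disputed] -/
theorem algEquiv_apply_mem_pts_ofTwoTorsion_iff [IsAlgClosed Ω] (σ : Ω ≃ₐ[F] Ω) (x : Ω) :
    σ x ∈ (ofTwoTorsion E Ω).pts ↔ x ∈ (ofTwoTorsion E Ω).pts := by
  conv_lhs => rw [← critMap_ofTwoTorsion_algEquiv E Ω σ]
  exact apply_mem_critMap_pts _ (σ : Ω →+* Ω)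

end Geom

end CriticalLocus

/-! ## At initial Θ-data -/

section Datum

open CriticalLocus

variable {F : Type u} {K : Type v} {Fbar : Type w} [Field F] [NumberField F] [Field K]
  [NumberField K] [Algebra F K] [Field Fbar] [Algebra F Fbar] [Algebra K Fbar]
  {E : WeierstrassCurve F} [E.IsElliptic] {l : ℕ} {P : BadPlacePredicates K}
  (D : InitialThetaData F K Fbar E l P)

namespace InitialThetaData

include D

/-- **F-rationality (Def. 3.1 (b), memo R4).** Every point of `D.critLocusAt Ω` is the image under
`F → Ω` of a point of the `F`-rational locus `D.critLocus`. [claim: Mochizuki2012, status: disputed] -/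
theorem exists_mem_pts_critLocus_eq_of_mem_critLocusAt (Ω : Type u') [Field Ω] [Algebra F Ω] {x : Ω}
    (hx : x ∈ (D.critLocusAt Ω).pts) : ∃ a ∈ D.critLocus.pts, algebraMap F Ω a = x :=
  (mem_critMap_pts _ _).mp hx

/-- **F-rationality at `F̄` (Def. 3.1 (b), memo R4).** Every geometric strictly critical point of the
datum is the image of an `F`-rational one: `D.critLocusGeom.pts ⊆ image of D.critLocus.pts`.
[claim: Mochizuki2012, status: disputed] -/
theorem exists_mem_pts_critLocus_eq {x : Fbar} (hx : x ∈ D.critLocusGeom.pts) :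
    ∃ a ∈ D.critLocus.pts, algebraMap F Fbar a = x := by
  rw [← critLocusAt_eq_critLocusGeom] at hx
  exact D.exists_mem_pts_critLocus_eq_of_mem_critLocusAt Fbar hx

/-- Conversely the image of an `F`-rational strictly critical point is a geometric one.
[claim: Mochizuki2012, status: disputed] -/
theorem algebraMap_mem_pts_critLocusGeom_iff (a : F) :
    algebraMap F Fbar a ∈ D.critLocusGeom.pts ↔ a ∈ D.critLocus.pts := by
  rw [← critLocusAt_eq_critLocusGeom]
  exact apply_mem_critMap_pts _ _

/-- The geometric points of the datum are exactly the images of the `F`-rational ones (as sets).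
[claim: Mochizuki2012, status: disputed] -/
theorem coe_pts_critLocusGeom_eq_image :
    (D.critLocusGeom.pts : Set Fbar) = algebraMap F Fbar '' (D.critLocus.pts : Set F) := by
  rw [← critLocusAt_eq_critLocusGeom]
  exact coe_critMap_pts _ _

/-- **`G_F` fixes the strictly critical points POINTWISE** (they are `F`-rational): for every
`σ ∈ G_F = Fbar ≃ₐ[F] Fbar` and every `e ∈ D.critLocusGeom.pts`, `σ e = e`.
[claim: Mochizuki2012, status: disputed] -/
theorem algEquiv_apply_of_mem_pts_critLocusGeom (σ : Fbar ≃ₐ[F] Fbar) {e : Fbar}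
    (he : e ∈ D.critLocusGeom.pts) : σ e = e := by
  obtain ⟨a, -, rfl⟩ := D.exists_mem_pts_critLocus_eq he
  exact σ.commutes a

/-- Every geometric strictly critical point of the datum is algebraic over `ℚ` (it lies in the number
field `F`). [claim: Mochizuki2012, status: disputed] -/
theorem isAlgebraic_of_mem_pts_critLocusGeom [CharZero Fbar] :
    ∀ e ∈ D.critLocusGeom.pts, IsAlgebraic ℚ e := by
  haveI := D.isAlgClosure
  haveI : IsAlgClosed Fbar := IsAlgClosure.isAlgClosed F
  exact isAlgebraic_of_mem_pts_ofTwoTorsion E Fbar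

/-- A geometric strictly critical point of the datum is a root in `F̄` of the `2`-division cubic.
[claim: Mochizuki2012, status: disputed] -/
theorem isRoot_of_mem_pts_critLocusGeom {x : Fbar} (hx : x ∈ D.critLocusGeom.pts) :
    (E.twoTorsionPolynomial.toPoly.map (algebraMap F Fbar)).IsRoot x := by
  haveI := D.isAlgClosure
  haveI : IsAlgClosed Fbar := IsAlgClosure.isAlgClosed F
  exact isRoot_of_mem_pts_ofTwoTorsion E Fbar hx

/-- The locus of the `K`-core: reading `D.critLocusGeom` for `E_K := E ×_F K` changes nothing (Def. 3.1
(d) "`C_K := C_F ×_F K`"), granted the scalar tower `F → K → F̄` of the datum.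
[claim: Mochizuki2012, status: disputed] -/
theorem ofTwoTorsion_baseChange_K [IsAlgClosed Fbar] :
    ofTwoTorsion (E.baseChange K) Fbar = D.critLocusGeom := by
  haveI := D.isScalarTower
  exact ofTwoTorsion_baseChange E Fbar

/-- **Transport of the ruled locus along ANY ring hom over `F` into ANY field** (no algebraic
closedness of the target needed): `D.critLocusGeom` goes to `D.critLocusAt Ω'` — e.g. along
`ι_v : F̄ ↪ K̄_v` the global locus becomes the datum's locus read in `K̄_v`, and along `F̄ → Λ` for a
bigger field `Λ` likewise. [claim: Mochizuki2012, status: disputed] -/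
theorem critMap_critLocusGeom_eq_critLocusAt {Ω' : Type v'} [Field Ω'] [Algebra F Ω']
    (ψ : Fbar →+* Ω') (hψ : ψ.comp (algebraMap F Fbar) = algebraMap F Ω') :
    D.critLocusGeom.critMap ψ = D.critLocusAt Ω' := by
  rw [← critLocusAt_eq_critLocusGeom]
  exact D.critMap_critLocusAt _ _ ψ hψ

/-- Transport inside a scalar tower `F → Ω → Ω'`: `D.critLocusAt Ω` read in `Ω'` is `D.critLocusAt Ω'`
(e.g. `K ↪ K_v`, `K_v ↪ K̄_v`, `F̄ ↪ K̄_v` when the algebra structures form towers over `F`).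
[claim: Mochizuki2012, status: disputed] -/
theorem critMap_critLocusAt_of_isScalarTower (Ω : Type u') [Field Ω] [Algebra F Ω] (Ω' : Type v')
    [Field Ω'] [Algebra F Ω'] [Algebra Ω Ω'] [IsScalarTower F Ω Ω'] :
    (D.critLocusAt Ω).critMap (algebraMap Ω Ω') = D.critLocusAt Ω' :=
  D.critMap_critLocusAt _ _ _ (IsScalarTower.algebraMap_eq F Ω Ω').symm

/-- In particular, in the datum's tower `F → K → F̄`: the `K`-rational reading transported to `F̄` is
the ruled locus. [claim: Mochizuki2012, status: disputed] -/
theorem critMap_critLocusAt_K : (D.critLocusAt K).critMap (algebraMap K Fbar) = D.critLocusGeom := by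
  haveI := D.isScalarTower
  rw [D.critMap_critLocusAt_of_isScalarTower K Fbar, critLocusAt_eq_critLocusGeom]

/-- **Rmk 3.1.7 (ii) AT THE DATUM'S GENUINE LOCUS** (`L̄ = F̄`): "there exists a `κ`-coric `f_sol` of
degree `4`" and "every element of `F̄` appears as a value of some `κ`-coric rational function at a
non-critical point". [claim: Mochizuki2012, status: disputed] -/
theorem critLocusGeom_rmk317ii [CharZero Fbar] :
    D.critLocusGeom.ExistsKappaCoricDegreeFour ∧ D.critLocusGeom.EveryValueAttained Set.univ := by
  haveI := D.isAlgClosure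
  haveI : IsAlgClosed Fbar := IsAlgClosure.isAlgClosed F
  exact ofTwoTorsion_rmk317ii E Fbar

/-- **Non-vacuity of `κ`-coricity at the datum.** There is a `κ`-coric rational function `f ∈ F̄(t)`
for `D.critLocusGeom` of degree `4` — in particular NOT a constant `RatFunc.C c` (a constant has
numerator of degree `0`). [claim: Mochizuki2012, status: disputed] -/
theorem exists_isKappaCoric_critLocusGeom [CharZero Fbar] :
    ∃ f : RatFunc Fbar, D.critLocusGeom.IsKappaCoric f ∧ f.num.natDegree = 4 ∧
      ∀ c : Fbar, f ≠ RatFunc.C c := by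
  obtain ⟨⟨f, hf, hdeg⟩, -⟩ := D.critLocusGeom_rmk317ii
  refine ⟨f, hf, hdeg, fun c hc => ?_⟩
  have h0 : f.num.natDegree = 0 := by rw [hc, RatFunc.num_C, natDegree_C]
  omega

/-- **Non-vacuity of `∞κ`-coricity at the datum, in any field `Λ ⊇ F̄(t)`** (e.g. GB-01's
`Λ := AlgebraicClosure (RatFunc Fbar)`): the image of the degree-`4` `κ`-coric function is an
`∞κ`-coric element of `Λ` that is not the image of a constant — so the `∞κ`-coric pseudo-monoid at the
datum's locus is not reduced to roots of unity. [claim: Mochizuki2012, status: disputed] -/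
theorem exists_isInftyKappaCoricIn_critLocusGeom [CharZero Fbar] (Λ : Type v') [Field Λ]
    [Algebra (RatFunc Fbar) Λ] :
    ∃ f : RatFunc Fbar, D.critLocusGeom.IsInftyKappaCoricIn Λ (algebraMap (RatFunc Fbar) Λ f) ∧
      ∀ c : Fbar, f ≠ RatFunc.C c := by
  obtain ⟨f, hf, -, hc⟩ := D.exists_isKappaCoric_critLocusGeom
  exact ⟨f, (D.critLocusGeom.isInftyKappaCoricIn_algebraMap_iff_isKappaCoric Λ f).mpr hf, hc⟩

end InitialThetaData

end Datum

end Literature.IUT.HodgeTheaters
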